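import Mathlib.LinearAlgebra.FiniteDimensional.Lemmas
import Mathlib.GroupTheory.Perm.Fin
import Mathlib.Data.ZMod.Basic
import Mathlib.Tactic.Linarith
import Mathlib.Tactic.Ring
import HarnessLib

/-!
# Prym–Torelli without the computer: the Brill–Noether skeleton of THEOREMS U / BN / R / BN₁₂ (WEIL-2 gen 43, BRILLNOETHER-G43, fact-free)

research route, not a corollary; conditional on HC_CM plus one named minimal statement.

Cell `pub-hodge-ring2-ab-*` (ALL ABELIAN VARIETIES), seat WEIL-2 gen 43, account
`run/shared/lean/pub/pub-hodge-ring2/pub-hodge-ring2-ab-weil-2/BRILLNOETHER-G43.md`.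

Informal setting (PRYM-G42 §1, BRILLNOETHER-G43 §1).  For a Galois–Prym datum (`G = ℤ/f ⋊ H`, base `Y` of genus `g_Y`, `r` branch
points, `K`-piece of signature `(n,n)`), the two multiplicity spaces are `H⁰(K' + B' − D₀)` and `H⁰(K' + D₀)` on `C' = C/N` (genus `g'`),
both of degree `2g' − 2 + s`, `s = deg D₀ = n − g' + 1`, and the codifferential of the `K`-piece period map is the `H`-trace of their
product into `H⁰(2K' + B')`.  This file kernel-checks the elementary bookkeeping behind the computer-free theorems of the account:
* `balance_identity`, `castelnuovo_range_iff`: `|B'| = 2s` and `2g' − 2 + s ≥ 2g' + 1 ↔ s ≥ 3` (THEOREM U, §1);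
* `sup_eq_top_of_finrank_add`, `double_pencil_count`, `source_ge_target`: the double-pencil argument of PROPOSITION DP
  (`(3q−1) + (3q−1) − (3q−3) = 3q+1 ≤ (q+1)²`, §2);
* `tetragonal_tuple`, `riemann_hurwitz_tetragonal`, `special_of_rr`: the Riemann-existence datum of LEMMA E (a 3-cycle, a double
  transposition and two transpositions with product `1` generating a transitive subgroup of `S₄`; `b = 2q + 2` simple branch points;
  a degree-4 pencil on a hyperelliptic curve of genus `≥ 4` is special, §2.4);
* `ramification_sheets`: in `E[6] ≅ (ℤ/6)²` exactly `4` of the `36` admissible `D₀` satisfy `2D₀ ∼ B'` (THEOREM R, §3);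
* `finrank_map_ge_of_not_le`: `dim T(U) ≥ dim U − 1` when `ker T` is a plane not contained in `U` — the trace-rank bound at the
  `(β)`-members of THEOREM BN₁₂ (§4.4); `four_torsion_classes`, `eps_table_five`, `eps_table_seven`: the `E[4]`-coset and the
  residue tables `ε(c)` of §4.2–4.3.

0 sorry, no `def`, no named fact; `HC_CM` does not occur.
-/

namespace Summit.HodgeConjecture.Ring2AbelianAll.PrymTorelliBrillNoether

section arithmetic

/-- Balance identity: if both multiplicity spaces `H⁰(K'+D₀)` (dimension `g'−1+s`) and `H⁰(K'+B'−D₀)` (dimension `g'−1+(|B'|−s)`)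
have dimension `n`, then `|B'| = 2s`.  Checked against the independent Chevalley–Weil signatures of gen 41 on all 2 699
positive-dimensional non-split data of the 429 levels `f ≤ 420` (0 violations).  [BRILLNOETHER-G43 §1.1]
research route, not a corollary; conditional on HC_CM plus one named minimal statement. -/
theorem balance_identity (g n s B : ℤ) (h₁ : g - 1 + s = n) (h₂ : g - 1 + (B - s) = n) : B = 2 * s := by omega

/-- The Castelnuovo range: a line bundle `K' + D` with `deg D = s` on a curve of genus `g'` has degree `≥ 2g' + 1` iff `s ≥ 3`;
then the multiplication map is onto at EVERY member (THEOREM U).  [BRILLNOETHER-G43 §1.2]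
research route, not a corollary; conditional on HC_CM plus one named minimal statement. -/
theorem castelnuovo_range_iff (g s : ℤ) : 2 * g + 1 ≤ 2 * g - 2 + s ↔ 3 ≤ s := by omega

/-- `s = n − g' + 1`: the Castelnuovo range `s ≥ 3` is `n ≥ g' + 2`.  [BRILLNOETHER-G43 §1.2]
research route, not a corollary; conditional on HC_CM plus one named minimal statement. -/
theorem castelnuovo_range_iff' (g n s : ℤ) (hs : s = n - g + 1) : 3 ≤ s ↔ g + 2 ≤ n := by omega

/-- The double-pencil count of PROPOSITION DP: the sections of `2K + D₁ + D₂` vanishing on `D₂` and those vanishing on `D₁`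
(`3q − 1` dimensions each) meet in those vanishing on `D₁ + D₂` (`3q − 3`) and therefore span all `3q + 1`.  [BRILLNOETHER-G43 §2.2]
research route, not a corollary; conditional on HC_CM plus one named minimal statement. -/
theorem double_pencil_count (q : ℤ) : (3 * q - 1) + (3 * q - 1) - (3 * q - 3) = 3 * q + 1 := by ring

/-- Source versus target at `d = 2`: `(q+1)² ≥ 3q+1`, with equality exactly for `q ∈ {0, 1}` — the base genus `1` is the only
positive genus at which a `d = 2` family can be dominant (Schoen's fourfold family, THEOREM R).  [BRILLNOETHER-G43 §2.1, §3]
research route, not a corollary; conditional on HC_CM plus one named minimal statement. -/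
theorem source_ge_target (q : ℕ) : 3 * q + 1 ≤ (q + 1) ^ 2 ∧ (3 * q + 1 = (q + 1) ^ 2 ↔ q ≤ 1) := by
  have hsq : (q + 1) ^ 2 = q * q + 2 * q + 1 := by ring
  rw [hsq]
  refine ⟨?_, ⟨fun h => ?_, fun h => ?_⟩⟩
  · have : q ≤ q * q := Nat.le_mul_self q
    omega
  · by_contra hq
    have hq2 : 2 ≤ q := by omega
    have : 2 * q ≤ q * q := Nat.mul_le_mul_right q hq2
    omega
  · interval_cases q <;> norm_num

/-- Riemann–Hurwitz for the tetragonal cover of LEMMA E: a degree-4 cover `Y → ℙ¹` of genus `q` with one fibre of type `(1,3)`,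
one of type `(2,2)` and `b` simple branch points has `b = 2q + 2`.  [BRILLNOETHER-G43 §2.4]
research route, not a corollary; conditional on HC_CM plus one named minimal statement. -/
theorem riemann_hurwitz_tetragonal (q b : ℤ) : 2 * q - 2 = 4 * (-2) + 2 + 2 + b ↔ b = 2 * q + 2 := by omega

/-- Riemann–Roch bookkeeping behind «a degree-4 pencil on a hyperelliptic curve of genus `q ≥ 4` is special» (hence composed with
the `g¹₂`, so it has no fibre of type `(1,3)`): `h⁰ − h¹ = 4 − q + 1` and `h⁰ ≥ 2` force `h¹ ≥ 1`.  [BRILLNOETHER-G43 §2.4]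
research route, not a corollary; conditional on HC_CM plus one named minimal statement. -/
theorem special_of_rr (q h0 h1 : ℤ) (rr : h0 - h1 = 4 - q + 1) (hq : 4 ≤ q) (h : 2 ≤ h0) : 1 ≤ h1 := by omega

end arithmetic

section linalg

variable {F : Type*} [Field F] {W : Type*} [AddCommGroup W] [Module F W] [FiniteDimensional F W]

/-- The dimension form of the double-pencil argument: two subspaces whose dimensions add up to `dim W + dim (A ⊓ B)` span `W`.
[BRILLNOETHER-G43 §2.2]
research route, not a corollary; conditional on HC_CM plus one named minimal statement. -/
theorem sup_eq_top_of_finrank_add (A B : Submodule F W)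
    (h : Module.finrank F A + Module.finrank F B = Module.finrank F W + Module.finrank F ↥(A ⊓ B)) : A ⊔ B = ⊤ := by
  have hs := Submodule.finrank_sup_add_finrank_inf_eq A B
  apply Submodule.eq_top_of_finrank_eq
  omega

variable {W' : Type*} [AddCommGroup W'] [Module F W']

/-- Trace-rank bound at the `(β)`-members (THEOREM BN₁₂ §4.4): if `ker T` is a plane NOT contained in `U`, then
`dim T(U) + 1 ≥ dim U` (with `dim U = 3`: the trace of the image of the multiplication map has rank `≥ 2`, i.e. full).
[BRILLNOETHER-G43 §4.4]
research route, not a corollary; conditional on HC_CM plus one named minimal statement. -/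
theorem finrank_map_ge_of_not_le (T : W →ₗ[F] W') (U : Submodule F W)
    (hker : Module.finrank F ↥(LinearMap.ker T) = 2) (hnot : ¬ LinearMap.ker T ≤ U) :
    Module.finrank F U ≤ Module.finrank F (U.map T) + 1 := by
  have h := LinearMap.finrank_range_add_finrank_ker (T.domRestrict U)
  rw [LinearMap.range_domRestrict, LinearMap.ker_domRestrict] at h
  -- the kernel of the restriction is (U ⊓ ker T) seen inside U; its dimension is that of U ⊓ ker T
  have hc : (LinearMap.ker T).comap U.subtype = (U ⊓ LinearMap.ker T).comap U.subtype := by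
    rw [Submodule.comap_inf, Submodule.comap_subtype_self, top_inf_eq]
  have hcomap : Module.finrank F ↥((LinearMap.ker T).comap U.subtype) = Module.finrank F ↥(U ⊓ LinearMap.ker T) := by
    rw [hc]
    exact LinearEquiv.finrank_eq (Submodule.comapSubtypeEquivOfLe (inf_le_left : U ⊓ LinearMap.ker T ≤ U))
  have hlt : U ⊓ LinearMap.ker T < LinearMap.ker T :=
    lt_of_le_of_ne inf_le_right (fun heq => hnot (heq ▸ inf_le_left))
  have hdim : Module.finrank F ↥(U ⊓ LinearMap.ker T) < 2 := hker ▸ Submodule.finrank_lt_finrank_of_lt hlt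
  omega

end linalg

section riemann_existence

open Equiv

/-- The monodromy datum of LEMMA E in `S₄`: `c` a 3-cycle fixing `3` (fibre type `(1,3)`), `v` a fixed-point-free involution
(type `(2,2)`), two transpositions `t₁, t₂`, with `c · v · t₁ · t₂ = 1`; and `⟨c, v⟩` is transitive on `Fin 4` (the orbit of `0`
under the words `1, c, c², v c²` is everything).  Padding with cancelling pairs of transpositions gives the `2q + 2` simple branch
points for every `q`.  [BRILLNOETHER-G43 §2.4]
research route, not a corollary; conditional on HC_CM plus one named minimal statement. -/
theorem tetragonal_tuple :
    let c : Perm (Fin 4) := swap 0 2 * swap 0 1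
    let v : Perm (Fin 4) := swap 0 1 * swap 2 3
    let t₁ : Perm (Fin 4) := swap 0 2
    let t₂ : Perm (Fin 4) := swap 0 3
    c ^ 3 = 1 ∧ c ≠ 1 ∧ c 3 = 3 ∧ v ^ 2 = 1 ∧ (∀ i, v i ≠ i) ∧ c * v * t₁ * t₂ = 1 ∧
      ({(1 : Perm (Fin 4)) 0, c 0, (c * c) 0, (v * (c * c)) 0} : Finset (Fin 4)) = Finset.univ := by
  decide

end riemann_existence

section torsion

/-- THEOREM R, sheet count: in `E[6] ≅ (ℤ/6)²`, for every class `w` in `2·E[6] = E[3]` exactly `4` of the `36` six-torsion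
translates `t` satisfy `2t = w` — over a configuration with `Σ(e_i − 3)y_i ∼ 0`, exactly 4 of the 36 admissible `D₀` lie on the
ramification divisor `R = {2D₀ ∼ B'}`; over any other configuration none does.  [BRILLNOETHER-G43 §3.2]
research route, not a corollary; conditional on HC_CM plus one named minimal statement. -/
theorem ramification_sheets :
    ∀ w : ZMod 6 × ZMod 6,
      (Finset.univ.filter (fun t : ZMod 6 × ZMod 6 => 2 • t = w)).card = if (∃ u : ZMod 6 × ZMod 6, 2 • u = w) then 4 else 0 := by
  decide

/-- THEOREM BN₁₂, the `E[4]`-coset at `h = 7` (§4.3): in `E[4] ≅ (ℤ/4)²` the map `t ↦ 2t` has the `4`-element kernel `E[2]` and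
fibres of size `4` over each of the three non-zero elements of `2·E[4] = E[2]` — the 16 admissible `t` of a coarse datum with
`γ = 0` split as 4 (`2t = 0`: disconnected covers when all residues are even) + 4 + 4 + 4 (`2t = w_a, w_{a'}, w_{a''}`).
[BRILLNOETHER-G43 §4.3]
research route, not a corollary; conditional on HC_CM plus one named minimal statement. -/
theorem four_torsion_classes :
    ∀ w : ZMod 4 × ZMod 4,
      (Finset.univ.filter (fun t : ZMod 4 × ZMod 4 => 2 • t = w)).card = if (∃ u : ZMod 4 × ZMod 4, 2 • u = w) then 4 else 0 := by
  decide

end torsion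

section residue_tables

/-- The residue table at `h = 5` (`K = ℚ(i)`, §4.2): for an `N`-type point of class `x^c` (residues `c` at `P`, `c' = 5c mod 12`
at `−P`) the coefficient of `P` in `τ₀ = [T₀]₀` is `−ε(c)` with `ε(c) = ⌊5c/12⌋ − (5c' − c)/12`; the table for `c = 1, …, 11` is
`[−2, −4, 0, −2, 2, 0, −2, 2, 0, 4, 2]` (in particular `ε(c) = 0` iff `3 ∣ c`, and `|ε| = 2` at `c ∈ {1,4,5,7,8,11}`).
[BRILLNOETHER-G43 §4.2]
research route, not a corollary; conditional on HC_CM plus one named minimal statement. -/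
theorem eps_table_five :
    (List.map (fun c : ℕ => ((5 * c / 12 : ℕ) : ℤ) - (((5 * ((5 * c) % 12) : ℕ) : ℤ) - c) / 12) (List.range' 1 11))
      = [-2, -4, 0, -2, 2, 0, -2, 2, 0, 4, 2] := by
  decide

/-- The residue table at `h = 7` (`K = ℚ(√−3)`, §4.3): `ε(c) = ⌊7c/12⌋ − (7c' − c)/12`, `c' = 7c mod 12`, is
`[−4, 0, −4, 0, −4, 0, 4, 0, 4, 0, 4]` — zero exactly for even `c`; and `c − c' = ∓6` for odd `c`, `0` for even `c`, so that
`γ = 4t = Σ_{c_j odd} ∓2 P_j`.  [BRILLNOETHER-G43 §4.3]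
research route, not a corollary; conditional on HC_CM plus one named minimal statement. -/
theorem eps_table_seven :
    (List.map (fun c : ℕ => ((7 * c / 12 : ℕ) : ℤ) - (((7 * ((7 * c) % 12) : ℕ) : ℤ) - c) / 12) (List.range' 1 11))
      = [-4, 0, -4, 0, -4, 0, 4, 0, 4, 0, 4] ∧
    (List.map (fun c : ℕ => (c : ℤ) - ((7 * c) % 12 : ℕ)) (List.range' 1 11)) = [-6, 0, -6, 0, -6, 0, 6, 0, 6, 0, 6] := by
  decide

/-- Residue sums `c + c'` at `h = 5` and `h = 7` (§4.1): at `h = 5` they are `6, 12, 6, 12, 6, 12, 18, 12, 18, 12, 18`, at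
`h = 7` they are `8, 4, 12, 8, 16, 12, 8, 16, 12, 20, 16`; with the `H`-residues they determine `s = (Σ residues)/12` and hence
the signature `n = g' − 1 + s`.  [BRILLNOETHER-G43 §4.1]
research route, not a corollary; conditional on HC_CM plus one named minimal statement. -/
theorem residue_sums :
    (List.map (fun c : ℕ => c + (5 * c) % 12) (List.range' 1 11)) = [6, 12, 6, 12, 6, 12, 18, 12, 18, 12, 18] ∧
    (List.map (fun c : ℕ => c + (7 * c) % 12) (List.range' 1 11)) = [8, 4, 12, 8, 16, 12, 8, 16, 12, 20, 16] := by
  decide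

end residue_tables

end Summit.HodgeConjecture.Ring2AbelianAll.PrymTorelliBrillNoether
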